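import Literature.Geometry.DiscreteGeometry.ThreePointKernelDimThree
import Summits.Ventures.PackingBounds.Energy.FivePointRieszSevenFacc1
import Summits.Ventures.PackingBounds.Energy.FivePointRieszSevenFgrp2
import Summits.Ventures.PackingBounds.Energy.FivePointRieszSevenFgrp0
import Summits.Ventures.PackingBounds.Energy.FivePointRieszSevenFgrp1
import HarnessLib

/-!
# `FivePointRieszSeven`: the tree's factored three-point function `threePointF3 6 32 dcoKR7 gwKR7` equals the expansion `FexpKR7`; the value of the bound

Framing: lottery ticket; floor = certified bounds/negative ranges. Venture `PackingBounds`, cell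
`pub-packcert`, energy family E3PT (pub-packcert-energy gen 12 generator `e3pt_lean_d6.py`, run by gen 17 from `code/e3pt/g17/kroute/`; KERNEL-D6 data route).
-/

noncomputable section

open Finset

namespace Summit.Ventures.PackingBounds.Energy.FivePointRieszSeven

open Literature.Geometry.DiscreteGeometry Literature.Geometry.DiscreteGeometry.BachocVallentin
open Literature.Analysis.SpecialFunctions

/-- `Σ_{k<6} f k` written out. -/
private theorem sum_range_blocksR7 (f : ℕ → ℝ) : ∑ k ∈ range 6, f k = f 0 + f 1 + f 2 + f 3 + f 4 + f 5 := by
  simp [Finset.sum_range_succ]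

set_option maxRecDepth 20000 in
set_option maxHeartbeats 400000000 in
/-- The last staged partial sum lands on `FexpKR7` (`ring`). -/
theorem fgrp_top_eqR7 (u v t : ℝ) : Facc1KR7 u v t + Fgrp2KR7 u v t = FexpKR7 u v t := by
  unfold Facc1KR7 Fgrp2KR7 FexpKR7
  ring

/-- The tree's factored three-point function equals `FexpKR7` (blockwise identities `fblk<k>_eq`, staged sums, `linear_combination`). -/
theorem threePointF3_eqR7 (u v t : ℝ) : threePointF3 6 32 dcoKR7 gwKR7 u v t = FexpKR7 u v t := by
  rw [threePointF3, sum_range_blocksR7, fblk0_eqR7, fblk1_eqR7, fblk2_eqR7, fblk3_eqR7, fblk4_eqR7, fblk5_eqR7]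
  linear_combination fgrp0_eqR7 u v t + fgrp1_eqR7 u v t + fgrp2_eqR7 u v t + facc1_eqR7 u v t + fgrp_top_eqR7 u v t

end Summit.Ventures.PackingBounds.Energy.FivePointRieszSeven
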